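import Summits.Ventures.LatticeQCDFlow.Scoring.TorusLocalLimit2D
import Summits.Ventures.LatticeQCDFlow.Scoring.ThermodynamicLimitTools
import Literature.MathematicalPhysics.QuantumFieldTheory.LatticeGaugeProofs
import HarnessLib

/-!
# The exact non-abelian area law in two dimensions, V-j: local observables of the infinite lattice `ℤ²` — every continuous cylinder observable has a thermodynamic limit along the tori

HONEST FRAMING: exact (Metropolis-corrected) sampling algorithms for lattice gauge theory;
figures of merit are autocorrelation/cost numbers at stated couplings and volumes; no
continuum-physics claim.

Venture `LatticeQCDFlow` (cell pub-lqcd), sub-topic `Scoring`; FANOUT row 5 (`s0-sun-a`), GEN-19.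
NEW WORK of the cell (placement rule).  Setting of `Literature…QuantumLattice.LatticeGaugeDLR` /
`…LatticeGaugeProofs`: configurations `LGConfig 2 G` on the edges of `ℤ²`, cylinder observables
`IsCylinder F S`, the periodic lift `torusLift (L+1)` and `toTorusObservable (L+1) F = F ∘ torusLift (L+1)`,
theory-2's torus Wilson states `wilsonExpectation ρ β` on `(ℤ/(L+1))²`; every compact second-countable gauge
group `G`, every continuous representation `ρ`, EVERY real `β`.

* (tools in `ThermodynamicLimitTools`: `measurePreserving_comp_of_injective`, the `(L+1)²`-squeeze;)
* §2 torus geometry of an `R × T` box of `ℤ²` (`proj_add_single`, `plaquetteHolonomy_proj`, `proj_box`,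
  `zbox_injective`, `toTorusObservable_update_eq`: a cylinder observable supported over the box, transported to
  the torus, only sees the links of the box's plaquettes);
* §3 **`tendsto_wilsonExpectation_cylinder_of_box`** — for a bounded continuous cylinder observable `F`
  whose support lies over an `R × T` box: `⟨F ∘ torusLift⟩_{(ℤ/(L+1))²,β} → ℓ_F` as `L → ∞`, where
  `ℓ_F = ∫ F(ū) ∏_{z∈box} w(ū_z) dHaar^{⊗E'}(u) / ∫ ∏_{z∈box} w(ū_z) dHaar^{⊗E'}(u)` is the FREE-BOUNDARY
  EXPECTATION over any finite edge set `E' ⊇ S` containing the box's links (`ū = padConfig E' u`,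
  `w = e^{−β(N − Re tr ρ)}`) — by V-h (`abs_wilsonExpectation_local_sub_le`, rate `(1 − c₀/m)^{(L+1)² − RT − 1}`)
  and §1 (the free-boundary expectation inside the torus does not depend on `L`);
  **`exists_tendsto_wilsonExpectation_cylinder`** — hence EVERY bounded continuous cylinder observable of
  two-dimensional lattice Yang–Mills has a thermodynamic limit along the full sequence of tori, at every
  coupling (the input of `LatticeGaugeProofs.HasTorusLimits`; the sequel upgrades to measurable observables
  and to `HasUniqueInfiniteVolumeLimit`).

No `def`, nothing cited as a fact, 0 sorry.
-/

noncomputable section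

open MeasureTheory Function Finset Filter Topology
open Literature.MathematicalPhysics.QuantumFieldTheory
open Literature.MathematicalPhysics.QuantumLattice
open Summit.Ventures.LatticeQCDFlow.Theory2.Lattice
open Summit.Ventures.LatticeQCDFlow.Theory2.Lattice.TwoDim

namespace Summit.Ventures.LatticeQCDFlow.Scoring

-- (`ℤ²` sites are `Literature.Probability.LatticeModels.Site 2`, edges `…QuantumLattice.ZdEdge 2`, reduction mod `n`
-- is `Literature.Probability.LatticeModels.Torus.proj`; written out in full — no local notation.)

/-! ## §2. Torus geometry of a box of `ℤ²` -/

section Geometry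

variable {G : Type*} [Group G]

omit [Group G] in
/-- Reduction modulo `n` commutes with the unit shifts. -/
theorem proj_add_single (n : ℕ) (z : (Literature.Probability.LatticeModels.Site 2)) (i : Fin 2) :
    Literature.Probability.LatticeModels.Torus.proj n (z + Pi.single i 1) = Site.shift (Literature.Probability.LatticeModels.Torus.proj n z : Site 2 n) i := by
  funext k
  simp only [Literature.Probability.LatticeModels.Torus.proj_apply, Site.shift, Pi.add_apply]
  by_cases h : k = i
  · subst h
    simp
  · simp [Pi.single_eq_of_ne h]

/-- The torus plaquette at the reduction of `z` is the `ℤ²` plaquette at `z` of the periodic lift. -/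
theorem plaquetteHolonomy_proj (n : ℕ) (U : GaugeConfig 2 n G) (z : (Literature.Probability.LatticeModels.Site 2)) :
    plaquetteHolonomy U (Literature.Probability.LatticeModels.Torus.proj n z) 0 1 = plaquetteHolonomyZd (torusLift n U) z 0 1 := by
  simp only [plaquetteHolonomy, plaquetteHolonomyZd, torusLift, Function.comp_apply, torusEdge,
    proj_add_single]

omit [Group G] in
/-- Reduction of the box parametrisation. -/
theorem proj_box (n : ℕ) (a b : ℤ) (q : ℕ × ℕ) :
    Literature.Probability.LatticeModels.Torus.proj n (![a + q.1, b + q.2] : (Literature.Probability.LatticeModels.Site 2)) = (![(a : ZMod n) + q.1, (b : ZMod n) + q.2] : Site 2 n) := by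
  funext k
  fin_cases k <;> simp [Literature.Probability.LatticeModels.Torus.proj_apply]

omit [Group G] in
/-- The parametrisation of an `R × T` box of `ℤ²` is injective. -/
theorem zbox_injective (a b : ℤ) : Injective (fun q : ℕ × ℕ => (![a + q.1, b + q.2] : (Literature.Probability.LatticeModels.Site 2))) := by
  intro q q' h
  have h0 := congr_fun h 0
  have h1 := congr_fun h 1
  simp only [Matrix.cons_val_zero, Matrix.cons_val_one] at h0 h1
  exact Prod.ext (by omega) (by omega)

omit [Group G] in
/-- The image of the box in the torus is the rectangle with the reduced corner. -/
theorem image_proj_box (n : ℕ) (a b : ℤ) (R T : ℕ) :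
    ((range R ×ˢ range T).image (fun q : ℕ × ℕ => (![a + q.1, b + q.2] : (Literature.Probability.LatticeModels.Site 2)))).image (Literature.Probability.LatticeModels.Torus.proj n) =
      (range R ×ˢ range T).image
        (fun q : ℕ × ℕ => (![(a : ZMod n) + q.1, (b : ZMod n) + q.2] : Site 2 n)) := by
  rw [Finset.image_image]
  exact Finset.image_congr fun q _ => proj_box n a b q

/-- Padding a restricted configuration gives back its values on the edge set. -/
theorem padConfig_restrict_apply {E' : Finset ((Literature.MathematicalPhysics.QuantumLattice.ZdEdge 2))} (V : LGConfig 2 G) {e : (Literature.MathematicalPhysics.QuantumLattice.ZdEdge 2)} (he : e ∈ E') :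
    padConfig E' (E'.restrict V) e = V e := by
  simp [padConfig, he]

omit [Group G] in
/-- **A cylinder observable supported over the box, transported to the torus, only sees the links of the
box's plaquettes**: updating any other link does not change `F ∘ torusLift`. -/
theorem toTorusObservable_update_eq {α : Type*} {F : LGConfig 2 G → α} {S : Finset ((Literature.MathematicalPhysics.QuantumLattice.ZdEdge 2))}
    (hF : IsCylinder F S) (n : ℕ) {a b : ℤ} {R T : ℕ}
    (hS : ∀ s ∈ S, s.1 ∈ (range R ×ˢ range T).image (fun q : ℕ × ℕ => (![a + q.1, b + q.2] : (Literature.Probability.LatticeModels.Site 2))))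
    {e : Edge 2 n} (U : GaugeConfig 2 n G) (g : G)
    (he : ∀ p ∈ (range R ×ˢ range T).image
        (fun q : ℕ × ℕ => (![(a : ZMod n) + q.1, (b : ZMod n) + q.2] : Site 2 n)),
      ((p, 0) : Edge 2 n) ≠ e ∧ ((Site.shift p 0, 1) : Edge 2 n) ≠ e ∧
        ((Site.shift p 1, 0) : Edge 2 n) ≠ e ∧ ((p, 1) : Edge 2 n) ≠ e) :
    toTorusObservable n F (update U e g) = toTorusObservable n F U := by
  simp only [toTorusObservable_apply]
  refine hF fun s hs => ?_
  have hs' : s ∈ S := Finset.mem_coe.1 hs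
  show (update U e g) (torusEdge n s) = U (torusEdge n s)
  have hp : Literature.Probability.LatticeModels.Torus.proj n s.1 ∈ (range R ×ˢ range T).image
      (fun q : ℕ × ℕ => (![(a : ZMod n) + q.1, (b : ZMod n) + q.2] : Site 2 n)) := by
    obtain ⟨q, hq, hqs⟩ := Finset.mem_image.1 (hS s hs')
    exact Finset.mem_image.2 ⟨q, hq, by rw [← proj_box, hqs]⟩
  obtain ⟨h0, -, -, h1⟩ := he _ hp
  refine update_of_ne (fun hEq => ?_) _ _
  have h01 : ∀ k : Fin 2, k = 0 ∨ k = 1 := by decide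
  rcases h01 s.2 with hk | hk
  · exact h0 (by rw [hEq.symm]; exact Prod.ext rfl hk.symm)
  · exact h1 (by rw [hEq.symm]; exact Prod.ext rfl hk.symm)

omit [Group G] in
/-- Continuity of the transported observable. -/
theorem continuous_toTorusObservable [TopologicalSpace G] (n : ℕ) {F : LGConfig 2 G → ℝ}
    (hF : Continuous F) : Continuous (toTorusObservable n F) := by
  have h : Continuous (torusLift (d := 2) (G := G) n) := by
    unfold torusLift
    fun_prop
  exact hF.comp h

end Geometry

/-! ## §3. The thermodynamic limit of a continuous cylinder observable -/

section Limit

variable {G : Type*} [Group G] [TopologicalSpace G] [IsTopologicalGroup G]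
  [CompactSpace G] [SecondCountableTopology G] [MeasurableSpace G] [BorelSpace G] {N : ℕ}
  (ρ : G →* Matrix (Fin N) (Fin N) ℂ)

omit [TopologicalSpace G] [IsTopologicalGroup G] [CompactSpace G] [SecondCountableTopology G]
  [MeasurableSpace G] [BorelSpace G] ρ in
/-- **The free-boundary integrand is a fixed function of the box's link variables.**  For a cylinder
observable `F` with support `S ⊆ E'`, `E'` containing the links of the box's plaquettes, and any weight `w`:
`F(torusLift U) ∏_{p ∈ box mod n} w(U_p) = g(u)` with `u = (U_{e mod n})_{e ∈ E'}` and
`g(u) = F(ū) ∏_{z ∈ box} w(ū_z)`, `ū = padConfig E' u` (`R, T ≤ n`). -/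
theorem toTorusObservable_mul_prod_box_eq {F : LGConfig 2 G → ℝ} {S E' : Finset ((Literature.MathematicalPhysics.QuantumLattice.ZdEdge 2))}
    (hF : IsCylinder F S) (hSE : S ⊆ E') {a b : ℤ} {R T : ℕ}
    (hE : ∀ z ∈ (range R ×ˢ range T).image (fun q : ℕ × ℕ => (![a + q.1, b + q.2] : (Literature.Probability.LatticeModels.Site 2))),
      ((z, 0) : (Literature.MathematicalPhysics.QuantumLattice.ZdEdge 2)) ∈ E' ∧ ((z + Pi.single 0 1, 1) : (Literature.MathematicalPhysics.QuantumLattice.ZdEdge 2)) ∈ E' ∧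
        ((z + Pi.single 1 1, 0) : (Literature.MathematicalPhysics.QuantumLattice.ZdEdge 2)) ∈ E' ∧ ((z, 1) : (Literature.MathematicalPhysics.QuantumLattice.ZdEdge 2)) ∈ E')
    (w : G → ℝ) {n : ℕ} (hRn : R ≤ n) (hTn : T ≤ n) (U : GaugeConfig 2 n G) :
    toTorusObservable n F U *
        ∏ p ∈ (range R ×ˢ range T).image
          (fun q : ℕ × ℕ => (![(a : ZMod n) + q.1, (b : ZMod n) + q.2] : Site 2 n)),
          w (plaquetteHolonomy U p 0 1) =
      (fun u : ↥E' → G => F (padConfig E' u) *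
        ∏ z ∈ (range R ×ˢ range T).image (fun q : ℕ × ℕ => (![a + q.1, b + q.2] : (Literature.Probability.LatticeModels.Site 2))),
          w (plaquetteHolonomyZd (padConfig E' u) z 0 1)) (fun i : ↥E' => U (torusEdge n i.1)) := by
  have hFE : IsCylinder F E' := DependsOn.mono (Finset.coe_subset.2 hSE) hF
  have hres : (fun i : ↥E' => U (torusEdge n i.1)) = E'.restrict (torusLift n U) := rfl
  simp only [toTorusObservable_apply]
  rw [hres, IsCylinder.apply_padConfig_restrict hFE]
  congr 1
  rw [Finset.prod_image (fun q hq q' hq' h => rect_injOn (a : ZMod n) (b : ZMod n) hRn hTn hq hq' h),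
    Finset.prod_image (fun q _ q' _ h => zbox_injective a b h)]
  refine Finset.prod_congr rfl fun q hq => ?_
  obtain ⟨h1, h2, h3, h4⟩ := hE _ (Finset.mem_image_of_mem _ hq)
  rw [← proj_box, plaquetteHolonomy_proj]
  simp only [plaquetteHolonomyZd, padConfig_restrict_apply _ h1, padConfig_restrict_apply _ h2,
    padConfig_restrict_apply _ h3, padConfig_restrict_apply _ h4]

omit ρ in
/-- **The free-boundary expectation inside the torus does not depend on the torus**: with `g` as above and
the reduction injective on `E'`, `∫ g((U_{e mod n})_{e∈E'}) dHaar^{⊗E_n}(U) = ∫ g dHaar^{⊗E'}`. -/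
theorem integral_comp_torusEdge_eq {E' : Finset ((Literature.MathematicalPhysics.QuantumLattice.ZdEdge 2))} {n : ℕ} [NeZero n]
    (hinj : Set.InjOn (torusEdge (d := 2) n) ↑E') {g : (↥E' → G) → ℝ} (hg : Continuous g) :
    ∫ U, g (fun i : ↥E' => U (torusEdge n i.1)) ∂(Measure.pi fun _ : Edge 2 n => haarProbability G) =
      ∫ u, g u ∂(Measure.pi fun _ : ↥E' => haarProbability G) := by
  have hc : Injective (fun i : ↥E' => torusEdge n i.1) := fun i j h =>
    Subtype.ext (hinj i.2 j.2 h)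
  have hmp := measurePreserving_comp_of_injective (haarProbability G) hc
  rw [← hmp.map_eq, integral_map hmp.measurable.aemeasurable hg.aestronglyMeasurable]

/-- **EXPONENTIALLY SMALL FINITE-SIZE CORRECTIONS FOR A CONTINUOUS CYLINDER OBSERVABLE** (two-dimensional
lattice Yang–Mills, every compact second-countable gauge group, continuous `ρ` with `|Re tr ρ| ≤ B`, EVERY real
`β`).  Let `F` be a bounded continuous cylinder observable on `G^{edges(ℤ²)}` (`|F| ≤ C`) whose support `S` lies
over the `R × T` box with corner `(a, b)`, and `E' ⊇ S` any finite edge set containing the links of the box's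
plaquettes.  Then for all large `L`:
`|⟨F ∘ torusLift⟩_{(ℤ/(L+1))²,β} − ℓ_F| ≤ 2C e^{2|β|(N+B)} (1 − e^{−|β|(N+B)}/m)^{(L+1)² − RT − 1}`, where
`ℓ_F = ∫ F(ū) ∏_{z∈box} w(ū_z) dHaar^{⊗E'} / ∫ ∏_{z∈box} w(ū_z) dHaar^{⊗E'}` is the free-boundary expectation
(`w = e^{−β(N − Re tr ρ)}`, `m = ∫ w dHaar`, `ū = padConfig E' u`): the convergence is exponential in the AREA. -/
theorem eventually_abs_wilsonExpectation_cylinder_sub_le (hρ : Continuous ρ) (β : ℝ) {B : ℝ}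
    (hB : ∀ g : G, |(ρ g).trace.re| ≤ B) {F : LGConfig 2 G → ℝ}
    {S E' : Finset ((Literature.MathematicalPhysics.QuantumLattice.ZdEdge 2))} (hFS : IsCylinder F S) (hFc : Continuous F) {C : ℝ} (hFb : ∀ U, |F U| ≤ C)
    (hSE : S ⊆ E') {a b : ℤ} {R T : ℕ}
    (hS : ∀ s ∈ S, s.1 ∈ (range R ×ˢ range T).image (fun q : ℕ × ℕ => (![a + q.1, b + q.2] : (Literature.Probability.LatticeModels.Site 2))))
    (hE : ∀ z ∈ (range R ×ˢ range T).image (fun q : ℕ × ℕ => (![a + q.1, b + q.2] : (Literature.Probability.LatticeModels.Site 2))),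
      ((z, 0) : (Literature.MathematicalPhysics.QuantumLattice.ZdEdge 2)) ∈ E' ∧ ((z + Pi.single 0 1, 1) : (Literature.MathematicalPhysics.QuantumLattice.ZdEdge 2)) ∈ E' ∧
        ((z + Pi.single 1 1, 0) : (Literature.MathematicalPhysics.QuantumLattice.ZdEdge 2)) ∈ E' ∧ ((z, 1) : (Literature.MathematicalPhysics.QuantumLattice.ZdEdge 2)) ∈ E') :
    ∀ᶠ L : ℕ in atTop, |wilsonExpectation (L := L + 1) ρ β (toTorusObservable (L + 1) F) -
        ((∫ u, F (padConfig E' u) *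
              ∏ z ∈ (range R ×ˢ range T).image (fun q : ℕ × ℕ => (![a + q.1, b + q.2] : (Literature.Probability.LatticeModels.Site 2))),
                Real.exp (-(β * ((N : ℝ) - (ρ (plaquetteHolonomyZd (padConfig E' u) z 0 1)).trace.re)))
              ∂(Measure.pi fun _ : ↥E' => haarProbability G)) /
          ∫ u, ∏ z ∈ (range R ×ˢ range T).image (fun q : ℕ × ℕ => (![a + q.1, b + q.2] : (Literature.Probability.LatticeModels.Site 2))),
                Real.exp (-(β * ((N : ℝ) - (ρ (plaquetteHolonomyZd (padConfig E' u) z 0 1)).trace.re)))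
              ∂(Measure.pi fun _ : ↥E' => haarProbability G))| ≤
      2 * C * Real.exp (2 * (|β| * (N + B))) *
        (1 - Real.exp (-(|β| * (N + B))) /
          ∫ g, Real.exp (-(β * ((N : ℝ) - (ρ g).trace.re))) ∂(haarProbability G)) ^ ((L + 1) ^ 2 - R * T - 1) := by
  have hw : Continuous fun g : G => Real.exp (-(β * ((N : ℝ) - (ρ g).trace.re))) := by
    have := Complex.continuous_re.comp hρ.matrix_trace
    fun_prop
  -- continuity of the two fixed integrands on `G^{E'}`
  have hpad : Continuous (padConfig (G := G) E') := continuous_padConfig E'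
  have hholc : ∀ z : (Literature.Probability.LatticeModels.Site 2), Continuous fun u : ↥E' → G => plaquetteHolonomyZd (padConfig E' u) z 0 1 := by
    intro z
    unfold plaquetteHolonomyZd
    fun_prop
  have hg1 : Continuous fun u : ↥E' → G =>
      ∏ z ∈ (range R ×ˢ range T).image (fun q : ℕ × ℕ => (![a + q.1, b + q.2] : (Literature.Probability.LatticeModels.Site 2))),
        Real.exp (-(β * ((N : ℝ) - (ρ (plaquetteHolonomyZd (padConfig E' u) z 0 1)).trace.re))) :=
    continuous_finsetProd _ fun z _ => hw.comp (hholc z)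
  have hgF : Continuous fun u : ↥E' → G => F (padConfig E' u) *
      ∏ z ∈ (range R ×ˢ range T).image (fun q : ℕ × ℕ => (![a + q.1, b + q.2] : (Literature.Probability.LatticeModels.Site 2))),
        Real.exp (-(β * ((N : ℝ) - (ρ (plaquetteHolonomyZd (padConfig E' u) z 0 1)).trace.re))) :=
    (hFc.comp hpad).mul hg1
  filter_upwards [eventually_injOn_torusEdge (d := 2) E', Filter.eventually_ge_atTop (R + T + 1)] with L hinj hL
  have hRL : R + 1 ≤ L + 1 := by omega
  have hTL : T + 1 ≤ L + 1 := by omega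
  -- V-h for the transported observable
  have h := abs_wilsonExpectation_local_sub_le (L := L + 1) ρ hρ β hB (by omega) ((a : ℤ) : ZMod (L + 1))
    ((b : ℤ) : ZMod (L + 1)) hRL hTL (Φ := toTorusObservable (L + 1) F)
    (continuous_toTorusObservable (L + 1) hFc)
    (fun e U g he => toTorusObservable_update_eq hFS (L + 1) hS U g he) (fun U => hFb _)
  -- the free-boundary expectation inside the torus is the fixed ratio
  have hnum : ∫ U, toTorusObservable (L + 1) F U *
        ∏ p ∈ (range R ×ˢ range T).image
          (fun q : ℕ × ℕ => (![((a : ℤ) : ZMod (L + 1)) + q.1, ((b : ℤ) : ZMod (L + 1)) + q.2] : Site 2 (L + 1))),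
          Real.exp (-(β * ((N : ℝ) - (ρ (plaquetteHolonomy U p 0 1)).trace.re)))
        ∂(Measure.pi fun _ : Edge 2 (L + 1) => haarProbability G) =
      ∫ u, F (padConfig E' u) *
        ∏ z ∈ (range R ×ˢ range T).image (fun q : ℕ × ℕ => (![a + q.1, b + q.2] : (Literature.Probability.LatticeModels.Site 2))),
          Real.exp (-(β * ((N : ℝ) - (ρ (plaquetteHolonomyZd (padConfig E' u) z 0 1)).trace.re)))
        ∂(Measure.pi fun _ : ↥E' => haarProbability G) := by
    rw [← integral_comp_torusEdge_eq hinj hgF]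
    refine integral_congr_ae (ae_of_all _ fun U => ?_)
    exact toTorusObservable_mul_prod_box_eq hFS hSE hE
      (fun g : G => Real.exp (-(β * ((N : ℝ) - (ρ g).trace.re)))) (n := L + 1) (by omega) (by omega) U
  have hden : ∫ U, ∏ p ∈ (range R ×ˢ range T).image
          (fun q : ℕ × ℕ => (![((a : ℤ) : ZMod (L + 1)) + q.1, ((b : ℤ) : ZMod (L + 1)) + q.2] : Site 2 (L + 1))),
          Real.exp (-(β * ((N : ℝ) - (ρ (plaquetteHolonomy U p 0 1)).trace.re)))
        ∂(Measure.pi fun _ : Edge 2 (L + 1) => haarProbability G) =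
      ∫ u, ∏ z ∈ (range R ×ˢ range T).image (fun q : ℕ × ℕ => (![a + q.1, b + q.2] : (Literature.Probability.LatticeModels.Site 2))),
          Real.exp (-(β * ((N : ℝ) - (ρ (plaquetteHolonomyZd (padConfig E' u) z 0 1)).trace.re)))
        ∂(Measure.pi fun _ : ↥E' => haarProbability G) := by
    rw [← integral_comp_torusEdge_eq hinj hg1]
    refine integral_congr_ae (ae_of_all _ fun U => ?_)
    have h1 := toTorusObservable_mul_prod_box_eq (F := fun _ : LGConfig 2 G => (1 : ℝ)) (S := S)
      (fun _ _ _ => rfl) hSE hE (fun g : G => Real.exp (-(β * ((N : ℝ) - (ρ g).trace.re))))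
      (n := L + 1) (by omega) (by omega) U
    simpa only [toTorusObservable_apply, one_mul] using h1
  rw [hnum, hden] at h
  exact h

/-- **THE THERMODYNAMIC LIMIT OF A CONTINUOUS CYLINDER OBSERVABLE, EXPLICIT FORM**: with `F`, the box and `E'` as
above, `⟨F ∘ torusLift⟩_{(ℤ/(L+1))²,β} → ℓ_F` as `L → ∞` — the limit is the free-boundary expectation. -/
theorem tendsto_wilsonExpectation_cylinder_of_box (hρ : Continuous ρ) (β : ℝ) {F : LGConfig 2 G → ℝ}
    {S E' : Finset ((Literature.MathematicalPhysics.QuantumLattice.ZdEdge 2))} (hFS : IsCylinder F S) (hFc : Continuous F) {C : ℝ} (hFb : ∀ U, |F U| ≤ C)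
    (hSE : S ⊆ E') {a b : ℤ} {R T : ℕ}
    (hS : ∀ s ∈ S, s.1 ∈ (range R ×ˢ range T).image (fun q : ℕ × ℕ => (![a + q.1, b + q.2] : (Literature.Probability.LatticeModels.Site 2))))
    (hE : ∀ z ∈ (range R ×ˢ range T).image (fun q : ℕ × ℕ => (![a + q.1, b + q.2] : (Literature.Probability.LatticeModels.Site 2))),
      ((z, 0) : (Literature.MathematicalPhysics.QuantumLattice.ZdEdge 2)) ∈ E' ∧ ((z + Pi.single 0 1, 1) : (Literature.MathematicalPhysics.QuantumLattice.ZdEdge 2)) ∈ E' ∧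
        ((z + Pi.single 1 1, 0) : (Literature.MathematicalPhysics.QuantumLattice.ZdEdge 2)) ∈ E' ∧ ((z, 1) : (Literature.MathematicalPhysics.QuantumLattice.ZdEdge 2)) ∈ E') :
    Tendsto (fun L : ℕ => wilsonExpectation (L := L + 1) ρ β (toTorusObservable (L + 1) F)) atTop
      (𝓝 ((∫ u, F (padConfig E' u) *
              ∏ z ∈ (range R ×ˢ range T).image (fun q : ℕ × ℕ => (![a + q.1, b + q.2] : (Literature.Probability.LatticeModels.Site 2))),
                Real.exp (-(β * ((N : ℝ) - (ρ (plaquetteHolonomyZd (padConfig E' u) z 0 1)).trace.re)))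
              ∂(Measure.pi fun _ : ↥E' => haarProbability G)) /
          ∫ u, ∏ z ∈ (range R ×ˢ range T).image (fun q : ℕ × ℕ => (![a + q.1, b + q.2] : (Literature.Probability.LatticeModels.Site 2))),
                Real.exp (-(β * ((N : ℝ) - (ρ (plaquetteHolonomyZd (padConfig E' u) z 0 1)).trace.re)))
              ∂(Measure.pi fun _ : ↥E' => haarProbability G))) := by
  obtain ⟨B, hB0, hB⟩ := exists_bound_trace_re_nonneg ρ hρ
  have hw : Continuous fun g : G => Real.exp (-(β * ((N : ℝ) - (ρ g).trace.re))) := by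
    have := Complex.continuous_re.comp hρ.matrix_trace
    fun_prop
  have hbound : ∀ g : G, |β * ((N : ℝ) - (ρ g).trace.re)| ≤ |β| * (N + B) := fun g => by
    rw [abs_mul]
    refine mul_le_mul_of_nonneg_left ?_ (abs_nonneg β)
    have h1 := hB g
    have h2 : |((N : ℝ) - (ρ g).trace.re)| ≤ |(N : ℝ)| + |(ρ g).trace.re| := abs_sub _ _
    rw [Nat.abs_cast] at h2
    linarith
  have hwlo : ∀ g : G, Real.exp (-(|β| * (N + B))) ≤ Real.exp (-(β * ((N : ℝ) - (ρ g).trace.re))) :=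
    fun g => Real.exp_le_exp.mpr (by linarith [(abs_le.mp (hbound g)).2])
  have hm_lo : Real.exp (-(|β| * (N + B))) ≤
      ∫ g, Real.exp (-(β * ((N : ℝ) - (ρ g).trace.re))) ∂(haarProbability G) := by
    have h : ∫ _g : G, Real.exp (-(|β| * (N + B))) ∂(haarProbability G) ≤
        ∫ g, Real.exp (-(β * ((N : ℝ) - (ρ g).trace.re))) ∂(haarProbability G) :=
      integral_mono (integrable_const _) (integrable_haarProbability_of_continuous hw) hwlo
    simpa using h
  have hm_pos : 0 < ∫ g, Real.exp (-(β * ((N : ℝ) - (ρ g).trace.re))) ∂(haarProbability G) :=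
    lt_of_lt_of_le (Real.exp_pos _) hm_lo
  have hq0 : 0 ≤ 1 - Real.exp (-(|β| * (N + B))) /
      ∫ g, Real.exp (-(β * ((N : ℝ) - (ρ g).trace.re))) ∂(haarProbability G) := by
    rw [sub_nonneg]
    exact (div_le_one hm_pos).mpr hm_lo
  have hq1 : 1 - Real.exp (-(|β| * (N + B))) /
      ∫ g, Real.exp (-(β * ((N : ℝ) - (ρ g).trace.re))) ∂(haarProbability G) < 1 := by
    have : 0 < Real.exp (-(|β| * (N + B))) /
        ∫ g, Real.exp (-(β * ((N : ℝ) - (ρ g).trace.re))) ∂(haarProbability G) :=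
      div_pos (Real.exp_pos _) hm_pos
    linarith
  exact tendsto_of_eventually_abs_sub_le_mul_pow hq0 hq1
    (eventually_abs_wilsonExpectation_cylinder_sub_le ρ hρ β hB hFS hFc hFb hSE hS hE)

/-- **EVERY BOUNDED CONTINUOUS CYLINDER OBSERVABLE OF TWO-DIMENSIONAL LATTICE YANG–MILLS HAS A THERMODYNAMIC
LIMIT ALONG THE TORI, AT EVERY COUPLING** (every compact second-countable gauge group, continuous `ρ`, real
`β`): `lim_{L→∞} ⟨F ∘ torusLift⟩_{(ℤ/(L+1))²,β}` exists. -/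
theorem exists_tendsto_wilsonExpectation_cylinder (hρ : Continuous ρ) (β : ℝ) {F : LGConfig 2 G → ℝ}
    {S : Finset ((Literature.MathematicalPhysics.QuantumLattice.ZdEdge 2))} (hFS : IsCylinder F S) (hFc : Continuous F) (hFb : ∃ C, ∀ U, |F U| ≤ C) :
    ∃ ℓ : ℝ, Tendsto (fun L : ℕ => wilsonExpectation (L := L + 1) ρ β (toTorusObservable (L + 1) F))
      atTop (𝓝 ℓ) := by
  classical
  obtain ⟨C, hC⟩ := hFb
  -- a box containing the support
  set M : ℕ := S.sup fun s => Finset.univ.sup fun i : Fin 2 => (s.1 i).natAbs with hM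
  have hMle : ∀ s ∈ S, ∀ i, |s.1 i| ≤ (M : ℤ) := fun s hs i => by
    rw [Int.abs_eq_natAbs, Int.ofNat_le]
    exact (Finset.le_sup (f := fun i : Fin 2 => (s.1 i).natAbs) (Finset.mem_univ i)).trans
      (Finset.le_sup (f := fun s : (Literature.MathematicalPhysics.QuantumLattice.ZdEdge 2) => Finset.univ.sup fun i : Fin 2 => (s.1 i).natAbs) hs)
  set Box : Finset (Literature.Probability.LatticeModels.Site 2) := (range (2 * M + 1) ×ˢ range (2 * M + 1)).image
    (fun q : ℕ × ℕ => (![-(M : ℤ) + q.1, -(M : ℤ) + q.2] : (Literature.Probability.LatticeModels.Site 2))) with hBox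
  have hS : ∀ s ∈ S, s.1 ∈ Box := fun s hs => by
    have h0 := abs_le.1 (hMle s hs 0)
    have h1 := abs_le.1 (hMle s hs 1)
    refine Finset.mem_image.2 ⟨((s.1 0 + M).toNat, (s.1 1 + M).toNat),
      Finset.mem_product.2 ⟨Finset.mem_range.2 (by omega), Finset.mem_range.2 (by omega)⟩, ?_⟩
    funext k
    have h01 : ∀ k : Fin 2, k = 0 ∨ k = 1 := by decide
    rcases h01 k with rfl | rfl
    · simp only [Matrix.cons_val_zero]
      omega
    · simp only [Matrix.cons_val_one, Matrix.cons_val_fin_one]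
      omega
  set E' : Finset ((Literature.MathematicalPhysics.QuantumLattice.ZdEdge 2)) :=
    (Box ∪ Box.image (· + Pi.single 0 1) ∪ Box.image (· + Pi.single 1 1)) ×ˢ Finset.univ with hE'
  have hSE : S ⊆ E' := fun s hs =>
    Finset.mem_product.2 ⟨Finset.mem_union_left _ (Finset.mem_union_left _ (hS s hs)), Finset.mem_univ _⟩
  have hE : ∀ z ∈ Box, ((z, 0) : (Literature.MathematicalPhysics.QuantumLattice.ZdEdge 2)) ∈ E' ∧ ((z + Pi.single 0 1, 1) : (Literature.MathematicalPhysics.QuantumLattice.ZdEdge 2)) ∈ E' ∧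
      ((z + Pi.single 1 1, 0) : (Literature.MathematicalPhysics.QuantumLattice.ZdEdge 2)) ∈ E' ∧ ((z, 1) : (Literature.MathematicalPhysics.QuantumLattice.ZdEdge 2)) ∈ E' := fun z hz =>
    ⟨Finset.mem_product.2 ⟨Finset.mem_union_left _ (Finset.mem_union_left _ hz), Finset.mem_univ _⟩,
      Finset.mem_product.2 ⟨Finset.mem_union_left _ (Finset.mem_union_right _
        (Finset.mem_image_of_mem _ hz)), Finset.mem_univ _⟩,
      Finset.mem_product.2 ⟨Finset.mem_union_right _ (Finset.mem_image_of_mem _ hz), Finset.mem_univ _⟩,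
      Finset.mem_product.2 ⟨Finset.mem_union_left _ (Finset.mem_union_left _ hz), Finset.mem_univ _⟩⟩
  exact ⟨_, tendsto_wilsonExpectation_cylinder_of_box ρ hρ β hFS hFc hC hSE hS hE⟩

end Limit

end Summit.Ventures.LatticeQCDFlow.Scoring
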